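import Summits.QuantumFields.YangMills.Theorems.AlphaInputsT3ACv3LocalSmall
import Literature.MathematicalPhysics.QuantumFieldTheory.Balaban1983to89.T4ReflectionConeSharp
import HarnessLib

/-!
# `AlphaInputsT3ACv3LocalSmallExact` — STRATEGY B for 2′: THE SMALL-LOOP CLASS LOCALISED TO THE **EXACT** DEPENDENCY CONES (both ends of every
# dependence bond in the two blocks `B(c₋) ∪ B(c₊)`): closed, and the averages of record continuous on it at the bonds of the family — lane
# `pub-balaban3d`, seat alpha-2 (g4)

WHY (HOME `pub-balaban3d` STATUS, alpha-2 g4 STARTED line).  The read-local class `𝒞_R(k,h,W)` (`…v3AdaptedClassR`) is cut by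
`localSmallT3 = NestedSmallOn ℰp (δ/2) (hull readBondsT3) k` whose hull is generated by the SOURCE-block relation `LocalSmallLoop.Feeds b c :=
blockOf b.src ∈ {c₋, c₊}` (`Setup.Averaging.local_dep`).  That hull LEAKS across the boundary of `Ω_k(h)`: it contains the bonds exiting the blocks
under `Ω_k(h)` and then every bond issuing from the outer target blocks, so `NestedSmallOn` asks the (0.4) loop variables at bonds whose two blocks
STRADDLE `∂Ω_k(h)` — the seams of the glued witness of (D6R-CHARGED) are not free.  The TRUE dependence of `blockAvg ℰ U c` is on the bonds with
BOTH ends in `B(c₋) ∪ B(c₊)` — the tree's `T4ReflectionConeSharp.TwoBlockLocal` (cell `pub-balaban`: `twoBlockLocal_blockAvg`, `loopHol_congr₂`,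
`axialAvg_congr₂`).  THIS FILE re-runs `…v3LocalSmall` §1 ∕ §3 over the exact relation: §1 `Feeds₂`, `DepClosed₂`, the exact hull `hull₂ R`
(`hull₂ R ⊆ hull R`, so `NestedSmallOn ℰ δ′ (hull₂ R) k ⊇ NestedSmallOn ℰ δ′ (hull R) k`: the exact-cone class is WEAKER — nothing is lost for a
non-emptiness row); §2 ★ `isClosed_nestedSmallOn₂`, ★ `continuousOn_iter_eval₂`, `continuousOn_plaqHol_iter₂`, `isClosed_nestedSmallOn_inter_plaqLe₂`,
`isClosed_nestedSmallOn_inter_eq₂` — the joint induction of `LocalSmallLoop.isClosed_nestedSmallOn_and_continuousOn` with `loopHol_congr₂` ∕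
`axialAvg_congr₂` replacing `loopHol_local` ∕ `axialAvg_local`.  With it the exact cones of the read bonds of `(k,h)` stay under `Ω_k(h)` (inner read
bonds) resp. under the `Λ_i(h)` (profile read bonds), and a configuration glued along `∂Ω_k(h)` is in the exact-cone class as soon as each piece is.
HONEST FRAMING.  Kernel topology; no estimate of [B7]∕[7]∕[B10]; count-neutral helper toward R3 2′ (`stub_laneRecordsV3`, items 19935∕19936); registry
untouched; nothing about d = 4, the continuum, or a mass gap.

References: T. Bałaban, Commun. Math. Phys. 109 (1987) 249–301 [Balaban1987RG1] ((0.4) p.253); CMP 98 (1985) 17–51 [Balaban1985Averaging] ((15) p.19).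
-/

set_option autoImplicit false

noncomputable section

open scoped Topology

namespace Summit.QuantumFields.YangMills.Theorems.LocalSmallLoop

open Set
open Literature.MathematicalPhysics.QuantumFieldTheory.Balaban1983to89
open Literature.MathematicalPhysics.QuantumFieldTheory.Balaban1983to89.AveragingRT (axialAvg)
open Literature.MathematicalPhysics.QuantumFieldTheory.Balaban1983to89.BlockAveraging (blockAvg blockAvg_avg avgFun corr Small loopHol Idx)
open Literature.MathematicalPhysics.QuantumFieldTheory.Balaban1983to89.T4ReflectionConeSharp (loopHol_congr₂ axialAvg_congr₂)
open Summit.QuantumFields.BalabanUV.T4Continuum.SubstrateBackground (continuous_eval)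
open Summit.QuantumFields.BalabanUV.T4Continuum.SubstrateBlockAvgContinuity (SmallContinuous continuous_loopHol continuous_axialAvg)

variable {P : Params} {G : Type*} [GaugeGroup G]

/-! ## §1 The exact locality relation, exactly dependency-closed families, the exact hull -/

/-- **THE EXACT LOCALITY RELATION OF THE BLOCK AVERAGING**: the level-`j` bond `b` has BOTH ends in the two blocks `B(c₋) ∪ B(c₊)` of the coarse bond
`c` — the dependence set of [Balaban1987RG1] (0.4) (`T4ReflectionConeSharp.TwoBlockLocal`). [cite: Balaban1987RG1, (0.4) p.253] -/
def Feeds₂ {j : ℕ} (b : PBond P j) (c : PBond P (j + 1)) : Prop :=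
  (blockOf b.src = c.src ∨ blockOf b.src = c.tgt) ∧ (blockOf b.tgt = c.src ∨ blockOf b.tgt = c.tgt)

/-- The exact relation refines the source-block relation `Feeds`. [folklore] -/
theorem feeds_of_feeds₂ {j : ℕ} {b : PBond P j} {c : PBond P (j + 1)} (h : Feeds₂ b c) : Feeds b c := h.1

/-- **AN EXACTLY DEPENDENCY-CLOSED FAMILY**: every bond exactly feeding a member of `E (i+1)` is a member of `E i`. [folklore] -/
def DepClosed₂ (E : (i : ℕ) → Set (PBond P i)) : Prop :=
  ∀ (i : ℕ) (c : PBond P (i + 1)), c ∈ E (i + 1) → ∀ (b : PBond P i), Feeds₂ b c → b ∈ E i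

/-- A dependency-closed family (for `Feeds`) is exactly dependency-closed. [folklore] -/
theorem depClosed₂_of_depClosed {E : (i : ℕ) → Set (PBond P i)} (hE : DepClosed E) : DepClosed₂ E :=
  fun i c hc b hb => hE i c hc b (feeds_of_feeds₂ hb)

/-- The inductive generation of the EXACT dependency hull: the read bonds, and every bond exactly feeding a member. [folklore] -/
inductive InHull₂ (R : (i : ℕ) → Set (PBond P i)) : (i : ℕ) → PBond P i → Prop
  | base {i : ℕ} {b : PBond P i} (hb : b ∈ R i) : InHull₂ R i b
  | feeds {i : ℕ} {b : PBond P i} {c : PBond P (i + 1)} (hc : InHull₂ R (i + 1) c) (hbc : Feeds₂ b c) : InHull₂ R i b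

/-- **THE EXACT DEPENDENCY HULL** of a family of read bonds: the least exactly dependency-closed family containing it. [folklore] -/
def hull₂ (R : (i : ℕ) → Set (PBond P i)) : (i : ℕ) → Set (PBond P i) :=
  fun i => {b | InHull₂ R i b}

/-- The read bonds lie in their exact hull. [folklore] -/
theorem subset_hull₂ (R : (i : ℕ) → Set (PBond P i)) (i : ℕ) : R i ⊆ hull₂ R i :=
  fun _ hb => InHull₂.base hb

/-- The exact hull is exactly dependency-closed. [folklore] -/
theorem depClosed₂_hull₂ (R : (i : ℕ) → Set (PBond P i)) : DepClosed₂ (hull₂ R) :=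
  fun _ _ hc _ hbc => InHull₂.feeds hc hbc

/-- The exact hull is the LEAST exactly dependency-closed family containing the read bonds. [folklore] -/
theorem hull₂_minimal {R E : (i : ℕ) → Set (PBond P i)} (hRE : ∀ i, R i ⊆ E i) (hE : DepClosed₂ E) (i : ℕ) : hull₂ R i ⊆ E i := by
  intro b hb
  induction hb with
  | base hb => exact hRE _ hb
  | feeds _ hbc ih => exact hE _ _ ih _ hbc

/-- The exact hull is monotone in the read bonds. [folklore] -/
theorem hull₂_mono {R R' : (i : ℕ) → Set (PBond P i)} (h : ∀ i, R i ⊆ R' i) (i : ℕ) : hull₂ R i ⊆ hull₂ R' i :=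
  hull₂_minimal (fun i => (h i).trans (subset_hull₂ R' i)) (depClosed₂_hull₂ R') i

/-- **THE EXACT HULL LIES IN THE SOURCE-BLOCK HULL** (`hull R` is dependency-closed, hence exactly so). [folklore] -/
theorem hull₂_subset_hull (R : (i : ℕ) → Set (PBond P i)) (i : ℕ) : hull₂ R i ⊆ hull R i :=
  hull₂_minimal (subset_hull R) (depClosed₂_of_depClosed (depClosed_hull R)) i

variable (ℰ : LoopAverage G)

/-- **THE EXACT-CONE CLASS CONTAINS THE SOURCE-CONE CLASS**: fewer bonds, fewer conditions. [cite: Balaban1987RG1, (0.4) p.253] -/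
theorem nestedSmallOn_hull_subset_hull₂ (δ' : ℝ) (R : (i : ℕ) → Set (PBond P i)) (k : ℕ) :
    NestedSmallOn ℰ δ' (hull R) k ⊆ (NestedSmallOn ℰ δ' (hull₂ R) k : Set (GaugeField P 0 G)) :=
  nestedSmallOn_antitone_family (hull₂_subset_hull R) k

variable {ℰ}

/-! ## §2 Closedness, and continuity of the averages of record at the bonds of an exactly closed family -/

section Continuity

variable [TopologicalSpace G] [IsTopologicalGroup G]

open Classical in
/-- **EXACT LOCALITY ⇒ LOCAL CONTINUITY OF THE LOOP VARIABLES**: if the bond variables of `V x` exactly feeding the coarse bond `c` are continuous on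
`A`, so is every (0.4) loop variable of `V x` at `c` (patch the other bonds by `1`: `loopHol_congr₂`). [cite: Balaban1987RG1, (0.4) p.253] -/
theorem continuousOn_loopHol_of_feeds₂ {X : Type*} [TopologicalSpace X] {j : ℕ} (hj : j + 1 ≤ P.m + P.K) {V : X → GaugeField P j G}
    {A : Set X} (c : PBond P (j + 1)) (hV : ∀ b : PBond P j, Feeds₂ b c → ContinuousOn (fun x => V x b) A) (i : Idx P) :
    ContinuousOn (fun x => loopHol (V x) c i) A := by
  let W : X → GaugeField P j G := fun x b => if Feeds₂ b c then V x b else 1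
  have hW : ContinuousOn W A := by
    refine continuousOn_pi.2 fun b => ?_
    by_cases hb : Feeds₂ b c
    · simp only [W, if_pos hb]; exact hV b hb
    · simp only [W, if_neg hb]; exact continuousOn_const
  have heq : (fun x => loopHol (V x) c i) = fun x => loopHol (W x) c i := by
    funext x
    exact congrFun (loopHol_congr₂ hj (V x) (W x) c fun b hb hb' => by
      simp only [W, Feeds₂, if_pos (show (blockOf b.src = c.src ∨ blockOf b.src = c.tgt) ∧
        (blockOf b.tgt = c.src ∨ blockOf b.tgt = c.tgt) from ⟨hb, hb'⟩)]) i
  rw [heq]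
  exact (continuous_loopHol c i).comp_continuousOn hW

open Classical in
/-- **EXACT LOCALITY ⇒ LOCAL CONTINUITY OF THE STRAIGHT-LINE TRANSPORTER** at `c` (`axialAvg_congr₂`). [cite: Balaban1984PropagatorsI, (1.7) p.18] -/
theorem continuousOn_axialAvg_of_feeds₂ {X : Type*} [TopologicalSpace X] {j : ℕ} (hj : j + 1 ≤ P.m + P.K) {V : X → GaugeField P j G}
    {A : Set X} (c : PBond P (j + 1)) (hV : ∀ b : PBond P j, Feeds₂ b c → ContinuousOn (fun x => V x b) A) :
    ContinuousOn (fun x => axialAvg (V x) c) A := by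
  let W : X → GaugeField P j G := fun x b => if Feeds₂ b c then V x b else 1
  have hW : ContinuousOn W A := by
    refine continuousOn_pi.2 fun b => ?_
    by_cases hb : Feeds₂ b c
    · simp only [W, if_pos hb]; exact hV b hb
    · simp only [W, if_neg hb]; exact continuousOn_const
  have heq : (fun x => axialAvg (V x) c) = fun x => axialAvg (W x) c := by
    funext x
    exact axialAvg_congr₂ hj (V x) (W x) c fun b hb hb' => by
      simp only [W, Feeds₂, if_pos (show (blockOf b.src = c.src ∨ blockOf b.src = c.tgt) ∧
        (blockOf b.tgt = c.src ∨ blockOf b.tgt = c.tgt) from ⟨hb, hb'⟩)]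
  rw [heq]
  exact ((continuous_apply c).comp continuous_axialAvg).comp_continuousOn hW

/-- **★ THE EXACT-CONE CLASS IS CLOSED AND THE AVERAGES OF RECORD ARE CONTINUOUS ON IT AT THE BONDS OF THE FAMILY** (the joint induction of
`isClosed_nestedSmallOn_and_continuousOn`, for an EXACTLY dependency-closed family `E`, margin `δ′ < ℰ.δ`). [cite: Balaban1987RG1, (0.4) p.253] -/
theorem isClosed_nestedSmallOn_and_continuousOn₂ (hd : Continuous (dist1 : G → ℝ)) (hE' : SmallContinuous ℰ) {δ' : ℝ} (hδ : δ' < ℰ.δ)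
    {E : (i : ℕ) → Set (PBond P i)} (hE : DepClosed₂ E) :
    ∀ k, k ≤ P.m + P.K → IsClosed (NestedSmallOn ℰ δ' E k) ∧
      ∀ b ∈ E k, ContinuousOn (fun U : GaugeField P 0 G => Averaging.iter (fun j => (blockAvg ℰ : Averaging P j G)) k U b) (NestedSmallOn ℰ δ' E k)
  | 0, _ => by
    rw [nestedSmallOn_zero]
    exact ⟨isClosed_univ, fun b _ => (continuous_eval b).continuousOn⟩
  | k + 1, hk => by
    obtain ⟨hcl, hco⟩ := isClosed_nestedSmallOn_and_continuousOn₂ hd hE' hδ hE k (Nat.le_of_succ_le hk)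
    have hloop : ∀ c ∈ E (k + 1), ∀ x : Idx P, ContinuousOn
        (fun U : GaugeField P 0 G => loopHol (Averaging.iter (fun j => (blockAvg ℰ : Averaging P j G)) k U) c x) (NestedSmallOn ℰ δ' E k) :=
      fun c hc x => continuousOn_loopHol_of_feeds₂ hk c (fun b hb => hco b (hE k c hc b hb)) x
    have hax : ∀ c ∈ E (k + 1), ContinuousOn
        (fun U : GaugeField P 0 G => axialAvg (Averaging.iter (fun j => (blockAvg ℰ : Averaging P j G)) k U) c) (NestedSmallOn ℰ δ' E k) :=
      fun c hc => continuousOn_axialAvg_of_feeds₂ hk c fun b hb => hco b (hE k c hc b hb)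
    refine ⟨?_, fun c hc => ?_⟩
    · rw [nestedSmallOn_succ_eq]
      have hset : NestedSmallOn ℰ δ' E k ∩ {U : GaugeField P 0 G | ∀ c ∈ E (k + 1), ∀ x : Idx P,
          dist1 (loopHol (Averaging.iter (fun j => (blockAvg ℰ : Averaging P j G)) k U) c x) ≤ δ'} =
          NestedSmallOn ℰ δ' E k ∩ ⋂ c : PBond P (k + 1), ⋂ (_ : c ∈ E (k + 1)), ⋂ x : Idx P, (NestedSmallOn ℰ δ' E k ∩
            (fun U => dist1 (loopHol (Averaging.iter (fun j => (blockAvg ℰ : Averaging P j G)) k U) c x)) ⁻¹' Iic δ') := by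
        ext U
        simp only [mem_inter_iff, mem_setOf_eq, mem_iInter, mem_preimage, mem_Iic]
        exact ⟨fun h => ⟨h.1, fun c hc x => ⟨h.1, h.2 c hc x⟩⟩, fun h => ⟨h.1, fun c hc x => (h.2 c hc x).2⟩⟩
      rw [hset]
      exact hcl.inter (isClosed_iInter fun c => isClosed_iInter fun hc => isClosed_iInter fun x =>
        ((hd.comp_continuousOn (hloop c hc x)).preimage_isClosed_of_isClosed hcl isClosed_Iic))
    · have hsub := nestedSmallOn_succ_subset (ℰ := ℰ) δ' E k
      have hfam : ContinuousOn (fun U : GaugeField P 0 G =>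
          (loopHol (Averaging.iter (fun j => (blockAvg ℰ : Averaging P j G)) k U) c ∘ ⇑(LoopAverage.enum (Idx P)).symm : Fin _ → G))
          (NestedSmallOn ℰ δ' E (k + 1)) :=
        continuousOn_pi.2 fun i => (hloop c hc _).mono hsub
      have hmaps : MapsTo (fun U : GaugeField P 0 G =>
          (loopHol (Averaging.iter (fun j => (blockAvg ℰ : Averaging P j G)) k U) c ∘ ⇑(LoopAverage.enum (Idx P)).symm : Fin _ → G))
          (NestedSmallOn ℰ δ' E (k + 1)) {W | ∀ i, dist1 (W i) < ℰ.δ} :=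
        fun U hU i => (hU k (Nat.lt_succ_self k) c hc _).trans_lt hδ
      have hΦ : ContinuousOn (fun U : GaugeField P 0 G =>
          ℰ.E (loopHol (Averaging.iter (fun j => (blockAvg ℰ : Averaging P j G)) k U) c ∘ ⇑(LoopAverage.enum (Idx P)).symm) *
            axialAvg (Averaging.iter (fun j => (blockAvg ℰ : Averaging P j G)) k U) c) (NestedSmallOn ℰ δ' E (k + 1)) :=
        ((hE' _).comp hfam hmaps).mul ((hax c hc).mono hsub)
      refine hΦ.congr fun U hU => ?_
      have hsm : Small ℰ (Averaging.iter (fun j => (blockAvg ℰ : Averaging P j G)) k U) c :=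
        fun x => (hU k (Nat.lt_succ_self k) c hc x).trans_lt hδ
      show (blockAvg ℰ).avg (Averaging.iter (fun j => (blockAvg ℰ : Averaging P j G)) k U) c = _
      rw [blockAvg_avg]
      show corr ℰ _ c * axialAvg _ c = _
      rw [corr, if_pos hsm]
      rfl

/-- **★ THE EXACT-CONE CLASS IS CLOSED.** [cite: Balaban1987RG1, (0.4) p.253] -/
theorem isClosed_nestedSmallOn₂ (hd : Continuous (dist1 : G → ℝ)) (hE' : SmallContinuous ℰ) {δ' : ℝ} (hδ : δ' < ℰ.δ)
    {E : (i : ℕ) → Set (PBond P i)} (hE : DepClosed₂ E) {k : ℕ} (hk : k ≤ P.m + P.K) : IsClosed (NestedSmallOn ℰ δ' E k) :=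
  (isClosed_nestedSmallOn_and_continuousOn₂ hd hE' hδ hE k hk).1

/-- **★ ON THE EXACT-CONE CLASS THE `s`-FOLD AVERAGE OF RECORD IS CONTINUOUS AT EVERY BOND OF `E s`**, `s ≤ k`. [cite: Balaban1987RG1, (0.4) p.253] -/
theorem continuousOn_iter_eval₂ (hd : Continuous (dist1 : G → ℝ)) (hE' : SmallContinuous ℰ) {δ' : ℝ} (hδ : δ' < ℰ.δ)
    {E : (i : ℕ) → Set (PBond P i)} (hE : DepClosed₂ E) {k : ℕ} (hk : k ≤ P.m + P.K) {s : ℕ} (hs : s ≤ k) {b : PBond P s} (hb : b ∈ E s) :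
    ContinuousOn (fun U : GaugeField P 0 G => Averaging.iter (fun j => (blockAvg ℰ : Averaging P j G)) s U b) (NestedSmallOn ℰ δ' E k) :=
  ((isClosed_nestedSmallOn_and_continuousOn₂ hd hE' hδ hE s (hs.trans hk)).2 b hb).mono (nestedSmallOn_antitone_level hs)

/-- On the exact-cone class the (0.4) loop variables of the `s`-fold average, `s < k`, at a bond of `E (s+1)` are continuous. [cite: Balaban1987RG1, (0.4) p.253] -/
theorem continuousOn_loopHol_iter₂ (hd : Continuous (dist1 : G → ℝ)) (hE' : SmallContinuous ℰ) {δ' : ℝ} (hδ : δ' < ℰ.δ)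
    {E : (i : ℕ) → Set (PBond P i)} (hE : DepClosed₂ E) {k : ℕ} (hk : k ≤ P.m + P.K) {s : ℕ} (hs : s < k) {c : PBond P (s + 1)}
    (hc : c ∈ E (s + 1)) (x : Idx P) :
    ContinuousOn (fun U : GaugeField P 0 G => loopHol (Averaging.iter (fun j => (blockAvg ℰ : Averaging P j G)) s U) c x)
      (NestedSmallOn ℰ δ' E k) :=
  continuousOn_loopHol_of_feeds₂ (Nat.succ_le_of_lt (lt_of_lt_of_le hs hk)) c
    (fun b hb => continuousOn_iter_eval₂ hd hE' hδ hE hk hs.le (hE s c hc b hb)) x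

/-- On the exact-cone class the plaquette variable of the `s`-fold average at a plaquette whose four bonds lie in `E s` is continuous, `s ≤ k`.
[cite: Balaban1987RG1, (0.4) p.253] -/
theorem continuousOn_plaqHol_iter₂ (hd : Continuous (dist1 : G → ℝ)) (hE' : SmallContinuous ℰ) {δ' : ℝ} (hδ : δ' < ℰ.δ)
    {E : (i : ℕ) → Set (PBond P i)} (hE : DepClosed₂ E) {k : ℕ} (hk : k ≤ P.m + P.K) {s : ℕ} (hs : s ≤ k) (q : Plaq P s)
    (h₁ : (⟨q.src, q.μ⟩ : PBond P s) ∈ E s) (h₂ : (⟨q.src.shift q.μ, q.ν⟩ : PBond P s) ∈ E s)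
    (h₃ : (⟨q.src.shift q.ν, q.μ⟩ : PBond P s) ∈ E s) (h₄ : (⟨q.src, q.ν⟩ : PBond P s) ∈ E s) :
    ContinuousOn (fun U : GaugeField P 0 G => GaugeField.plaqHol (Averaging.iter (fun j => (blockAvg ℰ : Averaging P j G)) s U) q)
      (NestedSmallOn ℰ δ' E k) := by
  unfold GaugeField.plaqHol
  exact (((continuousOn_iter_eval₂ hd hE' hδ hE hk hs h₁).mul (continuousOn_iter_eval₂ hd hE' hδ hE hk hs h₂)).mul
    (continuousOn_iter_eval₂ hd hE' hδ hE hk hs h₃).inv).mul (continuousOn_iter_eval₂ hd hE' hδ hE hk hs h₄).inv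

/-- A condition `dist1 (plaqHol ((blockAvg ℰ)^s U) q) ≤ t` at a plaquette read inside the family is closed relative to the exact-cone class.
[cite: Balaban1987RG1, (0.4) p.253] -/
theorem isClosed_nestedSmallOn_inter_plaqLe₂ (hd : Continuous (dist1 : G → ℝ)) (hE' : SmallContinuous ℰ) {δ' : ℝ} (hδ : δ' < ℰ.δ)
    {E : (i : ℕ) → Set (PBond P i)} (hE : DepClosed₂ E) {k : ℕ} (hk : k ≤ P.m + P.K) {s : ℕ} (hs : s ≤ k) (q : Plaq P s)
    (h₁ : (⟨q.src, q.μ⟩ : PBond P s) ∈ E s) (h₂ : (⟨q.src.shift q.μ, q.ν⟩ : PBond P s) ∈ E s)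
    (h₃ : (⟨q.src.shift q.ν, q.μ⟩ : PBond P s) ∈ E s) (h₄ : (⟨q.src, q.ν⟩ : PBond P s) ∈ E s) (t : ℝ) :
    IsClosed (NestedSmallOn ℰ δ' E k ∩ {U : GaugeField P 0 G |
      dist1 (GaugeField.plaqHol (Averaging.iter (fun j => (blockAvg ℰ : Averaging P j G)) s U) q) ≤ t}) :=
  (hd.comp_continuousOn (continuousOn_plaqHol_iter₂ hd hE' hδ hE hk hs q h₁ h₂ h₃ h₄)).preimage_isClosed_of_isClosed
    (isClosed_nestedSmallOn₂ hd hE' hδ hE hk) isClosed_Iic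

/-- A condition `(blockAvg ℰ)^s U (b) = w` at a bond of the family is closed relative to the exact-cone class (`G` Hausdorff).
[cite: Balaban1987RG1, (0.4) p.253] -/
theorem isClosed_nestedSmallOn_inter_eq₂ [T2Space G] (hd : Continuous (dist1 : G → ℝ)) (hE' : SmallContinuous ℰ) {δ' : ℝ} (hδ : δ' < ℰ.δ)
    {E : (i : ℕ) → Set (PBond P i)} (hE : DepClosed₂ E) {k : ℕ} (hk : k ≤ P.m + P.K) {s : ℕ} (hs : s ≤ k) {b : PBond P s} (hb : b ∈ E s)
    (w : G) :
    IsClosed (NestedSmallOn ℰ δ' E k ∩ {U : GaugeField P 0 G | Averaging.iter (fun j => (blockAvg ℰ : Averaging P j G)) s U b = w}) :=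
  (continuousOn_iter_eval₂ hd hE' hδ hE hk hs hb).preimage_isClosed_of_isClosed (isClosed_nestedSmallOn₂ hd hE' hδ hE hk) (isClosed_singleton (x := w))

end Continuity

end Summit.QuantumFields.YangMills.Theorems.LocalSmallLoop

end
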